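import Summits.CriticalPhenomena.PercolationContinuityZ3.Theorems.PercNearOneGluingNoHeavyQuantGatedShiftRates
import Summits.CriticalPhenomena.PercolationContinuityZ3.Theorems.PercNearOneGluingNoHeavyQuantFlowUncross
import HarnessLib

/-!
# QUANT lane R8, T-DEC: the SHIFT TRANSPORT of a DEC flow under a gate (part 2 of 3 for Conjecture R `LawDec.GatedShiftDEC`)

builds on p205010 (kernel theorem, internal audit signed; external expert review pending)

Support file (`--supports stmt-CriticalPhenomena-4575`), QUANT lane typer seat prim-quant-stmt (gen 25), rung R8 of
`run/shared/lean/prim/quant/LADDER.md`; memo `run/shared/lean/prim/quant/prim-quant-stmt-g25/GATE-INTERACTION-G25.md` §4.  One theorem, standard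
axioms, no sorries.  Uses the flow normal form (typer g22: `LawDec.FlowAtT`), `usage_pos_of_compat` (typer g23) and part 1 (`usage_shift_le`,
`usage_stay_le`).

THE MECHANISM.  Let `ν ≥ 0` have a flow at `(y, S, J)` on `{0..M}` and let `L` be obtained from `ν` by keeping a part `ν 0 − m` of the atom `0` in
place and moving EVERYTHING ELSE up by `k` (the part `m` of the atom `0` included): `L 0 = ν 0 − m`, `L k = m`, `L (h+k) = ν h` (`h ≥ 1`).  For
`ν = gate_q μ`, `m = q·μ 0` this is `L = gate_q(μ(· − k))`, the law of Conjecture R.  Shift every pair `(l, h) ↦ (l+k, h+k)` of the flow, split the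
zero row proportionally into a staying part (`(0, h+k)`, total `ν 0 − m`) and a moving part (`(k, h+k)`, total `m`): at the target `S + q·k` (`q ≤ 1`)
and layer `J + k` compatibility is inherited, every absorber `h + k` carries at most the load `h` carried (part 1), PROVIDED every charged mid `h ≤ J`
of `ν` compatible with `0` (`S < h`) has `h·q ≤ S` (the STAY CONDITION).  The general case of R must re-route the staying zero mass off the mids
`h > S/q` (memo §4: needed in 52 / 735 census layers) — not done here.

* **`LawDec.flowAtT_gatedShift`** — `FlowAtT y S J M ν →` (stay condition) `→ FlowAtT y (S + q·k) (J + k) (M + k) L`.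

[this work]; flow normal form / rates: this lane (typer g22, lead g21).  The gluing rows served [cite: KozmaNitzan2024, Conjecture 3 (p. 15)];
product measure [cite: Grimmett1999, §1.3 p. 10].
-/

noncomputable section

namespace Summit.CriticalPhenomena.PercolationContinuityZ3.Theorems

namespace Quant

open Finset

namespace LawDec

/-! ### The transport lemma -/

/-- **SHIFT TRANSPORT OF A FLOW UNDER A GATE.**  `ν ≥ 0` with a flow at `(y, S, J)` on `{0..M}` (`0 < y < 1`, `0 < S`), a kept part
`0 ≤ m ≤ ν 0`, a shift `k ≥ 1`, a rate `0 < q ≤ 1`, and the STAY CONDITION: every charged mid `h ≤ J` of `ν` compatible with `0` (`S < h`) has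
`h·q ≤ S`.  Then the law `L` (`L 0 = ν 0 − m`, `L k = m`, `L (h+k) = ν h` for `h ≥ 1`, `0` elsewhere) has a flow at `(y, S + q·k, J + k)` on
`{0..M+k}`: the shifted flow plus the staying zero pairs. [this work] -/
theorem flowAtT_gatedShift (y S q m : ℝ) (J M k : ℕ) (ν : ℕ → ℝ) (hy0 : 0 < y) (hy1 : y < 1) (hq0 : 0 < q) (hq1 : q ≤ 1)
    (hk : 1 ≤ k) (hS : 0 < S) (hν0 : ∀ h, 0 ≤ ν h) (hm0 : 0 ≤ m) (hm : m ≤ ν 0)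
    (hstay : ∀ h, 0 < ν h → h ≤ J → S < (h : ℝ) → (h : ℝ) * q ≤ S) (hF : FlowAtT y S J M ν) :
    FlowAtT y (S + q * k) (J + k) (M + k)
      (fun t => if t = 0 then ν 0 - m else if t = k then m else if k ≤ t then ν (t - k) else 0) := by
  classical
  obtain ⟨f, hf0, hsupp, hrow, hcap⟩ := hF
  set S' : ℝ := S + q * k with hS'
  set c₀ : ℝ := (ν 0 - m) / ν 0 with hc₀
  set c₁ : ℝ := m / ν 0 with hc₁
  have hc₀0 : 0 ≤ c₀ := div_nonneg (by linarith) (hν0 0)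
  have hc₁0 : 0 ≤ c₁ := div_nonneg hm0 (hν0 0)
  have hc01 : c₀ + c₁ ≤ 1 := by
    rcases (hν0 0).eq_or_lt with hz | hpos
    · simp [hc₀, hc₁, ← hz]
    · rw [hc₀, hc₁, ← add_div, div_le_one hpos]; linarith
  have hS'0 : 0 < S' := by have := mul_pos hq0 (show (0 : ℝ) < k by exact_mod_cast hk); linarith
  -- the zero row of `ν`
  have hrow0 : ∑ h ∈ Finset.range (M + 1), f 0 h = ν 0 := hrow 0 (Nat.zero_le J) (by simpa using hS)
  -- `0` is never an absorber
  have hf0col : ∀ l, f l 0 = 0 := by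
    intro l
    by_contra hne
    have hpos : 0 < f l 0 := lt_of_le_of_ne (hf0 l 0) (Ne.symm hne)
    obtain ⟨_, hlow, _, hadm⟩ := hsupp l 0 hpos
    rcases hadm with h1 | h2
    · omega
    · simp at h2; linarith [(Nat.cast_nonneg l : (0 : ℝ) ≤ l)]
  -- the transported flow
  let f' : ℕ → ℕ → ℝ := fun l' h' =>
    if h' < k then 0 else
    if l' = 0 then c₀ * f 0 (h' - k)
    else if l' = k then (if 2 * (k : ℝ) < S' then c₁ * f 0 (h' - k) else 0)
    else if k < l' ∧ 2 * (l' : ℝ) < S' ∧ l' ≤ J + k then f (l' - k) (h' - k)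
    else 0
  refine ⟨f', fun l' h' => ?_, fun l' h' hpos => ?_, fun l' hl'J hl'low => ?_, fun h' hh'M hh'abs => ?_⟩
  · -- nonnegativity
    simp only [f']
    split_ifs
    · exact le_rfl
    · exact mul_nonneg hc₀0 (hf0 _ _)
    · exact mul_nonneg hc₁0 (hf0 _ _)
    · exact le_rfl
    · exact hf0 _ _
    · exact le_rfl
  · -- support
    simp only [f'] at hpos
    by_cases hhk : h' < k
    · rw [if_pos hhk] at hpos; exact absurd hpos (lt_irrefl 0)
    rw [if_neg hhk] at hpos
    have hkh : k ≤ h' := not_lt.1 hhk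
    have hcast : (((h' - k : ℕ) : ℝ)) = (h' : ℝ) - k := by push_cast [Nat.cast_sub hkh]; ring
    -- extract a used pair of `ν`
    have key : ∀ l, 0 < f l (h' - k) → l ≤ J ∧ 2 * (l : ℝ) < S ∧ h' ≤ M + k ∧ (J + k + 1 ≤ h' ∨ S < (l : ℝ) + ((h' : ℝ) - k)) := by
      intro l hl
      obtain ⟨hlJ, hlow, hhM, hadm⟩ := hsupp l (h' - k) hl
      refine ⟨hlJ, hlow, by omega, ?_⟩
      rcases hadm with h1 | h2
      · left; omega
      · right; rwa [hcast] at h2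
    have hkR : (0 : ℝ) ≤ k := Nat.cast_nonneg k
    have hqk : q * k ≤ k := by nlinarith
    by_cases hl0 : l' = 0
    · subst hl0
      rw [if_pos rfl] at hpos
      have hfp : 0 < f 0 (h' - k) := by
        rcases (hf0 0 (h' - k)).eq_or_lt with hz | hz
        · rw [← hz, mul_zero] at hpos; exact absurd hpos (lt_irrefl 0)
        · exact hz
      obtain ⟨_, _, hhM, hadm⟩ := key 0 hfp
      refine ⟨Nat.zero_le _, by simpa using hS'0, hhM, ?_⟩
      rcases hadm with h1 | h2
      · exact Or.inl h1
      · right; simp at h2 ⊢; rw [hS']; linarith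
    rw [if_neg hl0] at hpos
    by_cases hlk : l' = k
    · subst hlk
      rw [if_pos rfl] at hpos
      by_cases hkl : 2 * (l' : ℝ) < S'
      · rw [if_pos hkl] at hpos
        have hfp : 0 < f 0 (h' - l') := by
          rcases (hf0 0 (h' - l')).eq_or_lt with hz | hz
          · rw [← hz, mul_zero] at hpos; exact absurd hpos (lt_irrefl 0)
          · exact hz
        obtain ⟨_, _, hhM, hadm⟩ := key 0 hfp
        refine ⟨by omega, hkl, hhM, ?_⟩
        rcases hadm with h1 | h2
        · exact Or.inl h1
        · right; simp at h2; rw [hS']; linarith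
      · rw [if_neg hkl] at hpos; exact absurd hpos (lt_irrefl 0)
    rw [if_neg hlk] at hpos
    by_cases hguard : k < l' ∧ 2 * (l' : ℝ) < S' ∧ l' ≤ J + k
    · rw [if_pos hguard] at hpos
      obtain ⟨hklt, hl'low, hl'J⟩ := hguard
      obtain ⟨_, _, hhM, hadm⟩ := key (l' - k) hpos
      refine ⟨hl'J, hl'low, hhM, ?_⟩
      rcases hadm with h1 | h2
      · exact Or.inl h1
      · right
        have hc2 : (((l' - k : ℕ) : ℝ)) = (l' : ℝ) - k := by push_cast [Nat.cast_sub hklt.le]; ring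
        rw [hc2] at h2; rw [hS']; linarith
    · rw [if_neg hguard] at hpos; exact absurd hpos (lt_irrefl 0)
  · -- row sums of the low atoms of `L`
    have reindex : ∀ g : ℕ → ℝ, (∀ h', h' < k → g h' = 0) →
        ∑ h' ∈ Finset.range (M + k + 1), g h' = ∑ h ∈ Finset.range (M + 1), g (h + k) := by
      intro g hg
      rw [show M + k + 1 = k + (M + 1) by omega, Finset.sum_range_add]
      rw [Finset.sum_eq_zero (fun h' hh' => hg h' (Finset.mem_range.1 hh')), zero_add]
      exact Finset.sum_congr rfl fun h _ => by rw [Nat.add_comm]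
    rw [reindex (f' l') (fun h' hh' => by simp only [f', if_pos hh'])]
    beta_reduce
    have hsimp : ∀ h : ℕ, f' l' (h + k) =
        (if l' = 0 then c₀ * f 0 h
         else if l' = k then (if 2 * (k : ℝ) < S' then c₁ * f 0 h else 0)
         else if k < l' ∧ 2 * (l' : ℝ) < S' ∧ l' ≤ J + k then f (l' - k) h else 0) := by
      intro h
      simp only [f', if_neg (by omega : ¬ (h + k < k)), Nat.add_sub_cancel]
    simp_rw [hsimp]
    have hν0m : ν 0 = 0 → m = 0 := fun hz => le_antisymm (by rw [← hz]; exact hm) hm0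
    by_cases hl0 : l' = 0
    · subst hl0
      simp only [if_true]
      rw [← Finset.mul_sum, hrow0, hc₀]
      rcases (hν0 0).eq_or_lt with hz | hpos
      · rw [← hz, hν0m hz.symm]; simp
      · field_simp
    by_cases hlk : l' = k
    · have hlow' : 2 * (k : ℝ) < S' := by rw [← hlk]; exact hl'low
      have e : ∀ h : ℕ, (if l' = 0 then c₀ * f 0 h
          else if l' = k then (if 2 * (k : ℝ) < S' then c₁ * f 0 h else 0)
          else if k < l' ∧ 2 * (l' : ℝ) < S' ∧ l' ≤ J + k then f (l' - k) h else 0) = c₁ * f 0 h := by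
        intro h; rw [if_neg hl0, if_pos hlk, if_pos hlow']
      rw [Finset.sum_congr rfl (fun h _ => e h), ← Finset.mul_sum, hrow0, if_neg hl0, if_pos hlk, hc₁]
      rcases (hν0 0).eq_or_lt with hz | hpos
      · rw [← hz, hν0m hz.symm]; simp
      · field_simp
    by_cases hkl : k ≤ l'
    · have hklt : k < l' := lt_of_le_of_ne hkl (Ne.symm hlk)
      have hg : k < l' ∧ 2 * (l' : ℝ) < S' ∧ l' ≤ J + k := ⟨hklt, hl'low, hl'J⟩
      have e : ∀ h : ℕ, (if l' = 0 then c₀ * f 0 h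
          else if l' = k then (if 2 * (k : ℝ) < S' then c₁ * f 0 h else 0)
          else if k < l' ∧ 2 * (l' : ℝ) < S' ∧ l' ≤ J + k then f (l' - k) h else 0) = f (l' - k) h := by
        intro h; rw [if_neg hl0, if_neg hlk, if_pos hg]
      rw [Finset.sum_congr rfl (fun h _ => e h), if_neg hl0, if_neg hlk, if_pos hkl]
      have hc2 : (((l' - k : ℕ) : ℝ)) = (l' : ℝ) - k := by push_cast [Nat.cast_sub hkl]; ring
      refine hrow (l' - k) (by omega) ?_
      rw [hc2]
      have hkR : (1 : ℝ) ≤ k := by exact_mod_cast hk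
      have hl'low2 : 2 * (l' : ℝ) < S + q * k := hl'low
      nlinarith
    · have hg : ¬ (k < l' ∧ 2 * (l' : ℝ) < S' ∧ l' ≤ J + k) := fun h => hkl h.1.le
      have e : ∀ h : ℕ, (if l' = 0 then c₀ * f 0 h
          else if l' = k then (if 2 * (k : ℝ) < S' then c₁ * f 0 h else 0)
          else if k < l' ∧ 2 * (l' : ℝ) < S' ∧ l' ≤ J + k then f (l' - k) h else 0) = 0 := by
        intro h; rw [if_neg hl0, if_neg hlk, if_neg hg]
      rw [Finset.sum_congr rfl (fun h _ => e h), if_neg hl0, if_neg hlk, if_neg hkl]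
      simp
  · -- absorber loads
    -- every term `usage·f` of `ν` is nonnegative (a used pair is admissible, so its usage is positive)
    have hterm : ∀ l h, 0 ≤ usage y S J l h * f l h := by
      intro l h
      rcases (hf0 l h).eq_or_lt with hz | hp
      · rw [← hz, mul_zero]
      · obtain ⟨_, hlow, _, hadm⟩ := hsupp l h hp
        have hlh : l < h := by
          rcases hadm with h1 | h2
          · omega
          · by_contra hc
            have : (h : ℝ) ≤ l := by exact_mod_cast not_lt.1 hc
            linarith [(Nat.cast_nonneg l : (0 : ℝ) ≤ l)]
        exact (mul_pos (usage_pos_of_compat y S J l h hy0 hy1 hlow hlh hadm) hp).le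
    by_cases hhk : h' < k
    · have hz : ∀ l' ∈ Finset.range (J + k + 1), usage y S' (J + k) l' h' * f' l' h' = 0 := fun l' _ => by
        simp only [f', if_pos hhk, mul_zero]
      rw [Finset.sum_eq_zero hz]
      show (0 : ℝ) ≤ (if h' = 0 then ν 0 - m else if h' = k then m else if k ≤ h' then ν (h' - k) else 0)
      by_cases h0 : h' = 0
      · rw [if_pos h0]; linarith
      · rw [if_neg h0, if_neg (by omega), if_neg (by omega)]
    have hkh : k ≤ h' := not_lt.1 hhk
    obtain ⟨h, rfl⟩ : ∃ h, h' = h + k := ⟨h' - k, by omega⟩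
    have hhM : h ≤ M := by omega
    have hkR : (0 : ℝ) ≤ k := Nat.cast_nonneg k
    have hqk : q * k ≤ 2 * k := by nlinarith
    -- value of `L` at `h + k`
    have hLval : (fun t : ℕ => if t = 0 then ν 0 - m else if t = k then m else if k ≤ t then ν (t - k) else 0) (h + k)
        = if h = 0 then m else ν h := by
      show (if h + k = 0 then ν 0 - m else if h + k = k then m else if k ≤ h + k then ν (h + k - k) else 0) = _
      by_cases hz : h = 0
      · rw [if_pos hz, if_neg (by omega), if_pos (by omega)]
      · rw [if_neg hz, if_neg (by omega), if_neg (by omega), if_pos (by omega), Nat.add_sub_cancel]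
    rw [hLval]
    -- case: `h` is a low atom of `ν` (then nothing is shipped to it)
    by_cases habs' : J + 1 ≤ h ∨ S ≤ 2 * (h : ℝ)
    swap
    · have habs : ¬ (J + 1 ≤ h ∨ S ≤ 2 * (h : ℝ)) := habs'
      have hfz : ∀ l, f l h = 0 := by
        intro l
        by_contra hne
        have hp : 0 < f l h := lt_of_le_of_ne (hf0 l h) (Ne.symm hne)
        obtain ⟨_, hlow, _, hadm⟩ := hsupp l h hp
        apply habs
        rcases hadm with h1 | h2
        · exact Or.inl h1
        · right; linarith [(Nat.cast_nonneg l : (0 : ℝ) ≤ l)]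
      have hz : ∀ l' ∈ Finset.range (J + k + 1), usage y S' (J + k) l' (h + k) * f' l' (h + k) = 0 := by
        intro l' _
        simp [f', if_neg hhk, hfz]
      rw [Finset.sum_eq_zero hz]
      split_ifs
      · exact hm0
      · exact hν0 h
    have habs : J + 1 ≤ h ∨ S ≤ 2 * (h : ℝ) := habs'
    -- the capacity of `ν` at `h`
    have hcapν : ∑ l ∈ Finset.range (J + 1), usage y S J l h * f l h ≤ ν h := hcap h hhM habs
    -- split the `L`-load into the staying zero pair (`l' = 0`) and the shifted pairs (`l' = k + l`)
    rw [show J + k + 1 = k + (J + 1) by omega, Finset.sum_range_add]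
    -- (i) among `l' < k` only `l' = 0` is charged
    have hfirst : ∑ l' ∈ Finset.range k, usage y S' (J + k) l' (h + k) * f' l' (h + k)
        ≤ c₀ * (usage y S J 0 h * f 0 h) := by
      rw [Finset.sum_eq_single 0]
      · simp only [f', if_neg hhk, if_true, Nat.add_sub_cancel]
        rcases (hf0 0 h).eq_or_lt with hz | hpos
        · rw [← hz]; simp only [mul_zero]; exact le_rfl
        · obtain ⟨_, _, _, hadm⟩ := hsupp 0 h hpos
          have hh0 : 0 < h := by
            rcases hadm with h1 | h2
            · omega
            · simp at h2; exact_mod_cast (show (0 : ℝ) < h by linarith)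
          have hνh : 0 < ν h := lt_of_lt_of_le
            (lt_of_lt_of_le (mul_pos (usage_pos_of_compat y S J 0 h hy0 hy1 (by simpa using hS) hh0 hadm) hpos)
              (Finset.single_le_sum (f := fun l => usage y S J l h * f l h) (fun l _ => hterm l h)
                (Finset.mem_range.2 (Nat.succ_pos J)))) hcapν
          have hus := usage_stay_le y S q J k h hy0 hy1 hS hh0 (by
            rcases hadm with h1 | h2
            · exact Or.inl h1
            · right; simpa using h2) (fun hhJ => hstay h hνh hhJ (by
              rcases hadm with h1 | h2
              · omega
              · simpa using h2))
          calc usage y S' (J + k) 0 (h + k) * (c₀ * f 0 h) = c₀ * (usage y S' (J + k) 0 (h + k) * f 0 h) := by ring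
            _ ≤ c₀ * (usage y S J 0 h * f 0 h) := mul_le_mul_of_nonneg_left (mul_le_mul_of_nonneg_right hus (hf0 0 h)) hc₀0
      · intro l' hl' hl'0
        rw [Finset.mem_range] at hl'
        simp only [f', if_neg hhk, if_neg hl'0, if_neg (by omega : l' ≠ k)]
        rw [if_neg (fun hc => by omega), mul_zero]
      · intro hk0; exact absurd (Finset.mem_range.2 (by omega)) hk0
    -- (ii) the shifted pairs
    have hsecond : ∑ l ∈ Finset.range (J + 1), usage y S' (J + k) (k + l) (h + k) * f' (k + l) (h + k)
        ≤ ∑ l ∈ Finset.range (J + 1), usage y S J l h * f l h - (1 - c₁) * (usage y S J 0 h * f 0 h) := by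
      have hsplit : ∑ l ∈ Finset.range (J + 1), usage y S J l h * f l h - (1 - c₁) * (usage y S J 0 h * f 0 h)
          = ∑ l ∈ Finset.range (J + 1), (if l = 0 then c₁ else 1) * (usage y S J l h * f l h) := by
        have e : ∀ l : ℕ, (if l = 0 then c₁ else 1) * (usage y S J l h * f l h)
            = usage y S J l h * f l h - (if l = 0 then (1 - c₁) * (usage y S J l h * f l h) else 0) := by
          intro l; split_ifs with hl
          · subst hl; ring
          · ring
        simp_rw [e]
        rw [Finset.sum_sub_distrib, Finset.sum_ite_eq' (Finset.range (J + 1)) 0, if_pos (Finset.mem_range.2 (Nat.succ_pos J))]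
      rw [hsplit]
      refine Finset.sum_le_sum fun l hl => ?_
      rw [Finset.mem_range] at hl
      rcases (hf0 l h).eq_or_lt with hz | hpos
      · -- unused pair of `ν`: the shifted term vanishes too
        have hz' : f l h = 0 := hz.symm
        have : f' (k + l) (h + k) = 0 := by
          by_cases hl0 : l = 0
          · subst hl0
            have h1 : (k ≠ 0) := by omega
            simp only [f', if_neg hhk, Nat.add_sub_cancel, add_zero, if_neg h1, if_true, hz', mul_zero, ite_self]
          · have h1 : k + l ≠ 0 := by omega
            have h2 : k + l ≠ k := by omega
            simp only [f', if_neg hhk, Nat.add_sub_cancel, Nat.add_sub_cancel_left, if_neg h1, if_neg h2, hz', ite_self]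
        rw [this, ← hz]; simp
      obtain ⟨hlJ, hlow, _, hadm⟩ := hsupp l h hpos
      have hlh : l < h := by
        rcases hadm with h1 | h2
        · omega
        · by_contra hc
          have : (h : ℝ) ≤ l := by exact_mod_cast not_lt.1 hc
          linarith [(Nat.cast_nonneg l : (0 : ℝ) ≤ l)]
      have hus : usage y S' (J + k) (k + l) (h + k) ≤ usage y S J l h := by
        rw [Nat.add_comm k l]
        exact usage_shift_le y S q J k l h hy0 hy1 (by linarith) hlow hlh hadm
      have hupos : 0 ≤ usage y S J l h := (usage_pos_of_compat y S J l h hy0 hy1 hlow hlh hadm).le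
      have hval : f' (k + l) (h + k) = 0 ∨ f' (k + l) (h + k) = (if l = 0 then c₁ else 1) * f l h := by
        by_cases hl0 : l = 0
        · subst hl0
          have h1 : (k ≠ 0) := by omega
          simp only [f', if_neg hhk, Nat.add_sub_cancel, add_zero, if_neg h1, if_true]
          by_cases hg : 2 * (k : ℝ) < S'
          · right; rw [if_pos hg]
          · left; rw [if_neg hg]
        · have h1 : k + l ≠ 0 := by omega
          have h2 : k + l ≠ k := by omega
          simp only [f', if_neg hhk, Nat.add_sub_cancel, Nat.add_sub_cancel_left, if_neg h1, if_neg h2, if_neg hl0]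
          by_cases hg : k < k + l ∧ 2 * ((k + l : ℕ) : ℝ) < S' ∧ k + l ≤ J + k
          · right; rw [if_pos hg, one_mul]
          · left; rw [if_neg hg]
      have hwnn : (0 : ℝ) ≤ (if l = 0 then c₁ else 1) := by split_ifs; exacts [hc₁0, zero_le_one]
      rcases hval with hv | hv
      · rw [hv, mul_zero]; exact mul_nonneg hwnn (hterm l h)
      · rw [hv]
        calc usage y S' (J + k) (k + l) (h + k) * ((if l = 0 then c₁ else 1) * f l h)
            = (if l = 0 then c₁ else 1) * (usage y S' (J + k) (k + l) (h + k) * f l h) := by ring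
          _ ≤ (if l = 0 then c₁ else 1) * (usage y S J l h * f l h) :=
            mul_le_mul_of_nonneg_left (mul_le_mul_of_nonneg_right hus (hf0 l h)) hwnn
    -- (iii) assemble
    have htot : c₀ * (usage y S J 0 h * f 0 h) +
        (∑ l ∈ Finset.range (J + 1), usage y S J l h * f l h - (1 - c₁) * (usage y S J 0 h * f 0 h)) ≤ ν h := by
      have := hterm 0 h
      nlinarith
    by_cases hz : h = 0
    · subst hz
      rw [if_pos rfl]
      have : ∀ l' ∈ Finset.range k, usage y S' (J + k) l' (0 + k) * f' l' (0 + k) = 0 := fun l' _ => by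
        simp [f', zero_add, hf0col]
      have h2 : ∀ l ∈ Finset.range (J + 1), usage y S' (J + k) (k + l) (0 + k) * f' (k + l) (0 + k) = 0 := fun l _ => by
        simp [f', zero_add, hf0col]
      rw [Finset.sum_eq_zero this, Finset.sum_eq_zero h2, add_zero]
      exact hm0
    · rw [if_neg hz]
      linarith [hfirst, hsecond, htot]

end LawDec

end Quant

end Summit.CriticalPhenomena.PercolationContinuityZ3.Theorems
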